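import Summits.QuantumFields.YangMills.Theorems.UniversalDetectorHankelMirror
import HarnessLib

/-!
# Route `UniversalDetector`, LINE g10-1 «Hankel tightness» — polarisation of the mirror form and discrete convexity

Ideator seat ym-idea-8 (generation 10, lens «dual»); toolkit for the support item `UniversalDetector.HankelLongitudinal`
(stmt-QuantumFields-24001) of rung R2a (`BalabanLadder.NT`).  Route-independent lattice facts, valid for EVERY compact
`G`, every lattice representation `r`, every `β ≥ 0` and every odd torus `(ℤ/(2L+1))⁴`:

* §8 discrete convexity: a non-negative LOG-CONVEX real sequence is midpoint-convex (`two_mul_le_add_of_sq_le_mul`),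
  its slopes are monotone (`slope_mono`), and a slope at distance `≥ k` from both ends of a window on which
  `0 ≤ g ≤ S` is at most `S/k` in absolute value (`abs_slope_le`);
* §9 polarisation: for the pair observable `W = P_p(0) + P_q(y)` (`y₀ = 0`) the mirror sequence
  `n ↦ Cov_T(W∘Θ₀, τ_{n e₀} W)` equals `D_p(n+δ_p) + D_q(n+δ_q) + 2·Cov_T(P_p(0), P_q(y + (n+δ_p) e₀))`
  (`pairMirror_eq`; reflection symmetry of the torus state `cov_plane_reflect` makes the two cross terms equal), and it
  is non-negative and log-convex on the reflection window (`pairMirror_nonneg`, `pairMirror_logConvex`);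
* §10 `abs_crossCov_step_le`: hence the cross kernel `t ↦ Cov_T(P_p(0), P_q(y + t e₀))` has unit-step increments
  `≤ (3/2)·S/k` wherever the three mirror sequences are bounded by `S` on a window of half-width `k` — the convexity
  engine of `HankelLongitudinal` (a Lipschitz modulus along the axes from reflection positivity alone).

HONEST FRAMING: no summit, rung or crux is proved here; not Clay.  Refs: Fröhlich–Israel–Lieb–Simon, Comm. Math.
Phys. 62 (1978) Thm. 2.1; Osterwalder–Seiler, Ann. Phys. 110 (1978) §2; Glimm–Jaffe (1987) §6.1 [folklore].
-/

set_option autoImplicit false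

noncomputable section

open MeasureTheory Filter Topology
open Literature.MathematicalPhysics.QuantumFieldTheory Literature.MathematicalPhysics.QuantumLattice
  Literature.Probability.LatticeModels
open Summit.QuantumFields.YangMills.Cruxes.OSLegsFromFemtoAndGap.DlrCollarTransfer
open Summit.QuantumFields.YangMills.Cruxes.NT.MirrorHankel (latticeConnectedCorr_eq_torusCov
  latticeConnectedCorr_mirror_nonneg latticeConnectedCorr_mirror_logConvex)
open Summit.QuantumFields.YangMills.Cruxes.UniversalDetectorPlaneTight (cov_plane_translate plane_configShift_neg)
open Summit.QuantumFields.YangMills.Theorems.InfVolRP (reflSite reflSite_reflSite plane_cfgReflect)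
open Summit.QuantumFields.YangMills.Cruxes.NT.ConjugateResponse (torusE_comp_cfgReflect)
open Summit.QuantumFields.YangMills.Cruxes.NT.MarkovMirror (torusE_add)
open Summit.QuantumFields.YangMills.Theorems.MirrorDomination (torusE_plane_site)

namespace Summit.QuantumFields.YangMills.Cruxes.UniversalDetectorHankel

/-! ## §8 Discrete convexity of non-negative log-convex sequences -/

/-- AM–GM step: `b² ≤ ac` with `a, b, c ≥ 0` gives `2b ≤ a + c`. [folklore] -/
theorem two_mul_le_add_of_sq_le_mul {a b c : ℝ} (ha : 0 ≤ a) (hc : 0 ≤ c) (h : b ^ 2 ≤ a * c) :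
    2 * b ≤ a + c := by
  by_contra hlt
  push Not at hlt
  have h2 := mul_self_lt_mul_self (by positivity : (0 : ℝ) ≤ a + c) hlt
  nlinarith [sq_nonneg (a - c), h2, h]

/-- **Slopes of a midpoint-convex sequence are monotone**: `g(i+1) − g(i) ≤ g(i+k+1) − g(i+k)` on the window. [folklore] -/
theorem slope_mono {g : ℕ → ℝ} {A B : ℕ} (hc : ∀ i, A ≤ i → i + 2 ≤ B → 2 * g (i + 1) ≤ g i + g (i + 2)) :
    ∀ (k i : ℕ), A ≤ i → i + k + 1 ≤ B → g (i + 1) - g i ≤ g (i + k + 1) - g (i + k)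
  | 0, i, _, _ => by simp
  | (k + 1), i, hi, hB => by
      have ih := slope_mono hc k i hi (by omega)
      have h2 := hc (i + k) (by omega) (by omega)
      rw [show i + (k + 1) + 1 = i + k + 2 from by ring, show i + (k + 1) = i + k + 1 from by ring]
      linarith

/-- Right telescoping: `k · (g(m+1) − g(m)) ≤ g(m+1+k) − g(m+1)`. [folklore] -/
theorem mul_slope_le_right {g : ℕ → ℝ} {A B : ℕ} (hc : ∀ i, A ≤ i → i + 2 ≤ B → 2 * g (i + 1) ≤ g i + g (i + 2)) :
    ∀ (k m : ℕ), A ≤ m → m + 1 + k ≤ B → (k : ℝ) * (g (m + 1) - g m) ≤ g (m + 1 + k) - g (m + 1)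
  | 0, m, _, _ => by simp
  | (k + 1), m, hm, hB => by
      have ih := mul_slope_le_right hc k m hm (by omega)
      have hs := slope_mono hc (k + 1) m hm (by omega)
      rw [show m + (k + 1) + 1 = m + 1 + (k + 1) from by ring, show m + (k + 1) = m + 1 + k from by ring] at hs
      push_cast
      linarith

/-- Left telescoping: `g(b+k) − g(b) ≤ k · (g(b+k+1) − g(b+k))`. [folklore] -/
theorem sub_le_mul_slope_left {g : ℕ → ℝ} {A B : ℕ} (hc : ∀ i, A ≤ i → i + 2 ≤ B → 2 * g (i + 1) ≤ g i + g (i + 2)) :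
    ∀ (k b : ℕ), A ≤ b → b + k + 1 ≤ B → g (b + k) - g b ≤ (k : ℝ) * (g (b + k + 1) - g (b + k))
  | 0, b, _, _ => by simp
  | (k + 1), b, hb, hB => by
      have ih := sub_le_mul_slope_left hc k (b + 1) (by omega) (by omega)
      have hs := slope_mono hc (k + 1) b hb (by omega)
      rw [show b + 1 + k = b + (k + 1) from by ring] at ih
      push_cast
      linarith

/-- **Slope bound for a non-negative midpoint-convex sequence**: if `0 ≤ g ≤ S` on `[A, B]` and the slope at `m` is at
distance `≥ k ≥ 1` from both ends (`A + k ≤ m`, `m + 1 + k ≤ B`), then `|g(m+1) − g(m)| ≤ S/k`. [folklore] -/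
theorem abs_slope_le {g : ℕ → ℝ} {A B : ℕ} (hc : ∀ i, A ≤ i → i + 2 ≤ B → 2 * g (i + 1) ≤ g i + g (i + 2)) {S : ℝ}
    (h0 : ∀ i, A ≤ i → i ≤ B → 0 ≤ g i) (hS : ∀ i, A ≤ i → i ≤ B → g i ≤ S) {m k : ℕ} (hk : 1 ≤ k)
    (hm1 : A + k ≤ m) (hm2 : m + 1 + k ≤ B) : |g (m + 1) - g m| ≤ S / k := by
  have hkpos : (0 : ℝ) < k := by exact_mod_cast hk
  rw [abs_le]
  constructor
  · obtain ⟨b, rfl⟩ : ∃ b, m = b + k := ⟨m - k, by omega⟩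
    have h := sub_le_mul_slope_left hc k b (by omega) (by omega)
    have h1 := h0 (b + k) (by omega) (by omega)
    have h2 := hS b (by omega) (by omega)
    rw [neg_le, neg_sub, le_div_iff₀ hkpos]
    linarith
  · have h := mul_slope_le_right hc k m (by omega) hm2
    have h1 := h0 (m + 1) (by omega) (by omega)
    have h2 := hS (m + 1 + k) (by omega) hm2
    rw [le_div_iff₀ hkpos]
    linarith

variable (G : Type) [Group G] [TopologicalSpace G] [IsTopologicalGroup G] [CompactSpace G]
  [MeasurableSpace G] [BorelSpace G] (r : LatticeRep G)

/-! ## §9 Polarisation of the mirror form of a pair of plane fields -/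

/-- The CROSS kernel along the time axis above a spatial offset `y`: `X_{p,q,y}(t) = Cov_T(P_p(0), P_q(y + t e₀))`. -/
def crossCov (β : ℝ) (L : ℕ) (p q : Fin 4 × Fin 4) (y : Site 4) (t : ℤ) : ℝ :=
  torusE G r β L (fun V => plane G r p 0 V * plane G r q (y + Pi.single 0 t) V) -
    torusE G r β L (plane G r p 0) * torusE G r β L (plane G r q (y + Pi.single 0 t))

/-- The pair observable `W = P_p(0) + P_q(y)`. -/
def pairObs (p q : Fin 4 × Fin 4) (y : Site 4) : LGConfig 4 G → ℝ := fun V => plane G r p 0 V + plane G r q y V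

/-- The mirror sequence of the pair observable: `n ↦ Cov_T(W∘Θ₀, τ_{n e₀} W)`. -/
def pairMirror (β : ℝ) (L : ℕ) (p q : Fin 4 × Fin 4) (y : Site 4) (n : ℕ) : ℝ :=
  latticeConnectedCorr r.ρ β (2 * L + 1) (fun V => pairObs G r p q y (cfgReflect V)) (pairObs G r p q y) n

/-- **Reflection symmetry of the plane two-point function**: `Cov_T(P_p(θ_p x), P_q(θ_q y)) = Cov_T(P_p(x), P_q(y))`
(the torus state is invariant under the site mirror; `plane_cfgReflect`). [cite: OsterwalderSeiler1978, §2] -/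
theorem cov_plane_reflect (β : ℝ) (L : ℕ) {p q : Fin 4 × Fin 4} (hp : p.1 < p.2) (hq : q.1 < q.2) (x y : Site 4) :
    torusE G r β L (fun V => plane G r p (reflSite p x) V * plane G r q (reflSite q y) V) -
        torusE G r β L (plane G r p (reflSite p x)) * torusE G r β L (plane G r q (reflSite q y)) =
      torusE G r β L (fun V => plane G r p x V * plane G r q y V) -
        torusE G r β L (plane G r p x) * torusE G r β L (plane G r q y) := by
  have h := torusE_comp_cfgReflect G r β L (fun U => plane G r p x U * plane G r q y U)
  simp only [plane_cfgReflect r hp, plane_cfgReflect r hq] at h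
  rw [h, torusE_plane_site G r β L p (reflSite p x) x, torusE_plane_site G r β L q (reflSite q y) y]

omit [Group G] [TopologicalSpace G] [IsTopologicalGroup G] [CompactSpace G] [MeasurableSpace G] [BorelSpace G] in
/-- A site in the time-zero slice is fixed by the site mirror. -/
theorem siteReflect_of_apply_zero (y : Site 4) (hy : y 0 = 0) : siteReflect y = y := by
  funext k
  by_cases hk : k = 0
  · subst hk; rw [siteReflect_apply_zero, hy, neg_zero]
  · rw [siteReflect_apply_of_ne _ hk]

/-- **Polarisation identity.**  For `y₀ = 0`:
`Cov_T(W∘Θ₀, τ_n W) = D_p(n+δ_p) + D_q(n+δ_q) + 2·X_{p,q,y}(n+δ_p)`, `W = P_p(0) + P_q(y)` — the two cross terms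
`Cov_T(P_p(−δ_p e₀), P_q(y+n e₀))` and `Cov_T(P_q(θ_q y), P_p(n e₀))` coincide by reflection symmetry and translation
invariance. [cite: OsterwalderSeiler1978, §2] -/
theorem pairMirror_eq (β : ℝ) (L : ℕ) {p q : Fin 4 × Fin 4} (hp : p.1 < p.2) (hq : q.1 < q.2) (y : Site 4)
    (hy : y 0 = 0) (n : ℕ) :
    pairMirror G r β L p q y n =
      diagCov G r β L p ((n : ℤ) + elec p) + diagCov G r β L q ((n : ℤ) + elec q) +
        2 * crossCov G r β L p q y ((n : ℤ) + elec p) := by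
  unfold pairMirror
  rw [latticeConnectedCorr_eq_torusCov G r β L (pairObs G r p q y) n]
  -- the four fields
  have hA : ∀ V, plane G r p 0 (cfgReflect V) = plane G r p (-Pi.single 0 (elec p)) V := fun V => by
    rw [plane_cfgReflect r hp 0 V]
    have h := reflSite_single p (0 : ℤ)
    rw [Pi.single_zero, zero_add] at h
    rw [h]
  have hyr : reflSite q y = y - Pi.single 0 (elec q) := by
    unfold reflSite; rw [siteReflect_of_apply_zero y hy]; unfold elec; split_ifs <;> simp
  have hB : ∀ V, plane G r q y (cfgReflect V) = plane G r q (y - Pi.single 0 (elec q)) V := fun V => by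
    rw [plane_cfgReflect r hq y V, hyr]
  have hC : ∀ V, plane G r p 0 (configShift (-(Pi.single 0 (n : ℤ))) V) = plane G r p (Pi.single 0 (n : ℤ)) V :=
    fun V => by
      have h := plane_configShift_neg r p (Pi.single 0 (n : ℤ)) (Pi.single 0 (n : ℤ)) V
      rwa [sub_self] at h
  have hD : ∀ V, plane G r q y (configShift (-(Pi.single 0 (n : ℤ))) V) = plane G r q (y + Pi.single 0 (n : ℤ)) V :=
    fun V => by
      have h := plane_configShift_neg r q (Pi.single 0 (n : ℤ)) (y + Pi.single 0 (n : ℤ)) V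
      rwa [add_sub_cancel_right] at h
  simp only [pairObs, hA, hB, hC, hD]
  -- expand the expectations
  have cA : Continuous fun V => plane G r p (-Pi.single 0 (elec p)) V := continuous_plane r p _
  have cB : Continuous fun V => plane G r q (y - Pi.single 0 (elec q)) V := continuous_plane r q _
  have cC : Continuous fun V => plane G r p (Pi.single 0 (n : ℤ)) V := continuous_plane r p _
  have cD : Continuous fun V => plane G r q (y + Pi.single 0 (n : ℤ)) V := continuous_plane r q _
  have cAC : Continuous fun V => plane G r p (-Pi.single 0 (elec p)) V * plane G r p (Pi.single 0 (n : ℤ)) V :=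
    cA.mul cC
  have cAD : Continuous fun V =>
      plane G r p (-Pi.single 0 (elec p)) V * plane G r q (y + Pi.single 0 (n : ℤ)) V := cA.mul cD
  have cBC : Continuous fun V =>
      plane G r q (y - Pi.single 0 (elec q)) V * plane G r p (Pi.single 0 (n : ℤ)) V := cB.mul cC
  have cBD : Continuous fun V =>
      plane G r q (y - Pi.single 0 (elec q)) V * plane G r q (y + Pi.single 0 (n : ℤ)) V := cB.mul cD
  have c1 : Continuous fun V => plane G r p (-Pi.single 0 (elec p)) V * plane G r p (Pi.single 0 (n : ℤ)) V +
      plane G r p (-Pi.single 0 (elec p)) V * plane G r q (y + Pi.single 0 (n : ℤ)) V := cAC.add cAD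
  have c2 : Continuous fun V => plane G r q (y - Pi.single 0 (elec q)) V * plane G r p (Pi.single 0 (n : ℤ)) V +
      plane G r q (y - Pi.single 0 (elec q)) V * plane G r q (y + Pi.single 0 (n : ℤ)) V := cBC.add cBD
  have c0p : Continuous fun V => plane G r p 0 V := continuous_plane r p 0
  have c0q : Continuous fun V => plane G r q y V := continuous_plane r q y
  have e1 : (fun V => (plane G r p (-Pi.single 0 (elec p)) V + plane G r q (y - Pi.single 0 (elec q)) V) *
        (plane G r p (Pi.single 0 (n : ℤ)) V + plane G r q (y + Pi.single 0 (n : ℤ)) V)) =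
      fun V => (plane G r p (-Pi.single 0 (elec p)) V * plane G r p (Pi.single 0 (n : ℤ)) V +
          plane G r p (-Pi.single 0 (elec p)) V * plane G r q (y + Pi.single 0 (n : ℤ)) V) +
        (plane G r q (y - Pi.single 0 (elec q)) V * plane G r p (Pi.single 0 (n : ℤ)) V +
          plane G r q (y - Pi.single 0 (elec q)) V * plane G r q (y + Pi.single 0 (n : ℤ)) V) := by
    funext V; ring
  rw [e1, torusE_add G r β L c1 c2, torusE_add G r β L cAC cAD, torusE_add G r β L cBC cBD, torusE_add G r β L cA cB,
    show pairObs G r p q y = fun V => plane G r p 0 V + plane G r q y V from rfl, torusE_add G r β L c0p c0q]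
  -- all plane means are site-independent: `μ_p`, `μ_q`
  have mA : torusE G r β L (plane G r p (-Pi.single 0 (elec p))) = torusE G r β L (plane G r p 0) :=
    torusE_plane_site G r β L p _ 0
  have mB : torusE G r β L (plane G r q (y - Pi.single 0 (elec q))) = torusE G r β L (plane G r q 0) :=
    torusE_plane_site G r β L q _ 0
  have mqy : torusE G r β L (plane G r q y) = torusE G r β L (plane G r q 0) := torusE_plane_site G r β L q y 0
  -- the four product expectations
  have t1 : torusE G r β L (fun V => plane G r p (-Pi.single 0 (elec p)) V * plane G r p (Pi.single 0 (n : ℤ)) V) =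
      diagCov G r β L p ((n : ℤ) + elec p) + torusE G r β L (plane G r p 0) * torusE G r β L (plane G r p 0) := by
    have h := cov_plane_translate r β L p p (-Pi.single 0 (elec p)) (Pi.single 0 (n : ℤ))
    have hs : (Pi.single 0 (n : ℤ) : Site 4) - -Pi.single 0 (elec p) = Pi.single 0 ((n : ℤ) + elec p) := by
      rw [sub_neg_eq_add, ← Pi.single_add]
    have m1 : torusE G r β L (plane G r p (Pi.single 0 (n : ℤ))) = torusE G r β L (plane G r p 0) :=
      torusE_plane_site G r β L p _ 0
    have m2 : torusE G r β L (plane G r p (Pi.single 0 ((n : ℤ) + elec p))) = torusE G r β L (plane G r p 0) :=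
      torusE_plane_site G r β L p _ 0
    rw [hs, mA, m1, m2] at h
    unfold diagCov
    rw [m2]
    linarith
  have t2 : torusE G r β L (fun V => plane G r p (-Pi.single 0 (elec p)) V * plane G r q (y + Pi.single 0 (n : ℤ)) V) =
      crossCov G r β L p q y ((n : ℤ) + elec p) + torusE G r β L (plane G r p 0) * torusE G r β L (plane G r q 0) := by
    have h := cov_plane_translate r β L p q (-Pi.single 0 (elec p)) (y + Pi.single 0 (n : ℤ))
    have hs : y + (Pi.single 0 (n : ℤ) : Site 4) - -Pi.single 0 (elec p) = y + Pi.single 0 ((n : ℤ) + elec p) := by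
      rw [sub_neg_eq_add, add_assoc, ← Pi.single_add]
    have m1 : torusE G r β L (plane G r q (y + Pi.single 0 (n : ℤ))) = torusE G r β L (plane G r q 0) :=
      torusE_plane_site G r β L q _ 0
    have m2 : torusE G r β L (plane G r q (y + Pi.single 0 ((n : ℤ) + elec p))) = torusE G r β L (plane G r q 0) :=
      torusE_plane_site G r β L q _ 0
    rw [hs, mA, m1, m2] at h
    unfold crossCov
    rw [m2]
    linarith
  have t3 : torusE G r β L (fun V => plane G r q (y - Pi.single 0 (elec q)) V * plane G r p (Pi.single 0 (n : ℤ)) V) =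
      crossCov G r β L p q y ((n : ℤ) + elec p) + torusE G r β L (plane G r q 0) * torusE G r β L (plane G r p 0) := by
    have hcomm : (fun V => plane G r q (y - Pi.single 0 (elec q)) V * plane G r p (Pi.single 0 (n : ℤ)) V) =
        fun V => plane G r p (Pi.single 0 (n : ℤ)) V * plane G r q (y - Pi.single 0 (elec q)) V := by
      funext V; ring
    have h3 := cov_plane_reflect G r β L hp hq (reflSite p (Pi.single 0 (n : ℤ))) y
    have hr := reflSite_single p (n : ℤ)
    rw [reflSite_reflSite, hyr, hr] at h3
    have h4 := cov_plane_translate r β L p q (-Pi.single 0 ((n : ℤ) + elec p)) y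
    have hs3 : y - -(Pi.single 0 ((n : ℤ) + elec p) : Site 4) = y + Pi.single 0 ((n : ℤ) + elec p) :=
      sub_neg_eq_add _ _
    have m1 : torusE G r β L (plane G r p (Pi.single 0 (n : ℤ))) = torusE G r β L (plane G r p 0) :=
      torusE_plane_site G r β L p _ 0
    have m2 : torusE G r β L (plane G r q (y + Pi.single 0 ((n : ℤ) + elec p))) = torusE G r β L (plane G r q 0) :=
      torusE_plane_site G r β L q _ 0
    have m3 : torusE G r β L (plane G r p (-Pi.single 0 ((n : ℤ) + elec p))) = torusE G r β L (plane G r p 0) :=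
      torusE_plane_site G r β L p _ 0
    rw [hs3, m3, mqy, m2] at h4
    rw [m1, mB, m3, mqy] at h3
    rw [hcomm]
    unfold crossCov
    rw [m2]
    linarith
  have t4 : torusE G r β L (fun V => plane G r q (y - Pi.single 0 (elec q)) V * plane G r q (y + Pi.single 0 (n : ℤ)) V) =
      diagCov G r β L q ((n : ℤ) + elec q) + torusE G r β L (plane G r q 0) * torusE G r β L (plane G r q 0) := by
    have h := cov_plane_translate r β L q q (y - Pi.single 0 (elec q)) (y + Pi.single 0 (n : ℤ))
    have hs : y + (Pi.single 0 (n : ℤ) : Site 4) - (y - Pi.single 0 (elec q)) = Pi.single 0 ((n : ℤ) + elec q) := by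
      rw [show y + (Pi.single 0 (n : ℤ) : Site 4) - (y - Pi.single 0 (elec q)) =
        Pi.single 0 (n : ℤ) + Pi.single 0 (elec q) from by abel, ← Pi.single_add]
    have m1 : torusE G r β L (plane G r q (y + Pi.single 0 (n : ℤ))) = torusE G r β L (plane G r q 0) :=
      torusE_plane_site G r β L q _ 0
    have m2 : torusE G r β L (plane G r q (Pi.single 0 ((n : ℤ) + elec q))) = torusE G r β L (plane G r q 0) :=
      torusE_plane_site G r β L q _ 0
    rw [hs, mB, m1, m2] at h
    unfold diagCov
    rw [m2]
    linarith
  rw [t1, t2, t3, t4, mA, mB, mqy]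
  ring

omit [IsTopologicalGroup G] [CompactSpace G] [BorelSpace G] in
/-- The pair observable is a bounded continuous cylinder observable in the window `[0, 2)` (`y₀ = 0`). [folklore] -/
theorem pairObs_isCylinder (p q : Fin 4 × Fin 4) (y : Site 4) :
    IsCylinder (pairObs G r p q y)
      ((originPlaquetteSupport p.1 p.2).image (fun e => (e.1 - -(0 : Site 4), e.2)) ∪
        (originPlaquetteSupport q.1 q.2).image (fun e => (e.1 - -y, e.2))) := by
  intro U V h
  show plane G r p 0 U + plane G r q y U = plane G r p 0 V + plane G r q y V
  rw [isCylinder_plane r p 0 (fun e he => h e (Finset.mem_coe.2 (Finset.mem_union_left _ (Finset.mem_coe.1 he)))),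
    isCylinder_plane r q y (fun e he => h e (Finset.mem_coe.2 (Finset.mem_union_right _ (Finset.mem_coe.1 he))))]

/-- Window of the pair observable: all links based at times `0, 1` (`y₀ = 0`). [folklore] -/
theorem pairObs_window (p q : Fin 4 × Fin 4) (y : Site 4) (hy : y 0 = 0) :
    ∀ e ∈ (originPlaquetteSupport p.1 p.2).image (fun e => (e.1 - -(0 : Site 4), e.2)) ∪
        (originPlaquetteSupport q.1 q.2).image (fun e => (e.1 - -y, e.2)), 0 ≤ e.1 0 ∧ e.1 0 + 1 ≤ ((2 : ℕ) : ℤ) := by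
  intro e he
  rcases Finset.mem_union.1 he with he | he
  · have h := near_of_mem_supp_plane he 0
    simp only [Pi.zero_apply, sub_zero] at h
    constructor <;> push_cast <;> linarith [h.1, h.2]
  · have h := near_of_mem_supp_plane he 0
    rw [hy, sub_zero] at h
    constructor <;> push_cast <;> linarith [h.1, h.2]

/-- **Non-negativity of the pair mirror sequence** on the reflection window (`n + 4 ≤ 2L`). [cite: OsterwalderSeiler1978, §2] -/
theorem pairMirror_nonneg {β : ℝ} (hβ : 0 ≤ β) {L : ℕ} (hL : 1 ≤ L) (p q : Fin 4 × Fin 4) (y : Site 4)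
    (hy : y 0 = 0) {n : ℕ} (hn : n + 4 ≤ 2 * L) : 0 ≤ pairMirror G r β L p q y n := by
  haveI := r.secondCountableTopology
  obtain ⟨K, hK⟩ := exists_abs_plane_le r
  have hc : Continuous (pairObs G r p q y) := (continuous_plane r p 0).add (continuous_plane r q y)
  have hb : ∀ V, |pairObs G r p q y V| ≤ K + K := fun V =>
    (abs_add_le _ _).trans (add_le_add (hK p 0 V) (hK q y V))
  unfold pairMirror
  exact latticeConnectedCorr_mirror_nonneg (r := r) (T := 2) hβ hL hc.measurable hb (pairObs_isCylinder G r p q y)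
    (pairObs_window p q y hy) (by omega)

/-- **Log-convexity of the pair mirror sequence** on the reflection window (`n + 6 ≤ 2L`).
[cite: FrohlichIsraelLiebSimon1978, Thm. 2.1] -/
theorem pairMirror_logConvex {β : ℝ} (hβ : 0 ≤ β) {L : ℕ} (hL : 1 ≤ L) (p q : Fin 4 × Fin 4) (y : Site 4)
    (hy : y 0 = 0) {n : ℕ} (hn : n + 6 ≤ 2 * L) :
    pairMirror G r β L p q y (n + 1) ^ 2 ≤ pairMirror G r β L p q y n * pairMirror G r β L p q y (n + 2) := by
  haveI := r.secondCountableTopology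
  obtain ⟨K, hK⟩ := exists_abs_plane_le r
  have hc : Continuous (pairObs G r p q y) := (continuous_plane r p 0).add (continuous_plane r q y)
  have hb : ∀ V, |pairObs G r p q y V| ≤ K + K := fun V =>
    (abs_add_le _ _).trans (add_le_add (hK p 0 V) (hK q y V))
  unfold pairMirror
  exact latticeConnectedCorr_mirror_logConvex (r := r) (T := 2) hβ hL hc.measurable hb (pairObs_isCylinder G r p q y)
    (pairObs_window p q y hy) (by omega)

/-! ## §10 The Lipschitz step of the cross kernel -/

/-- **Unit-step increments of the cross kernel from reflection positivity.**  On a lag window `[A, B]` with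
`B + 4 ≤ 2L` on which the three mirror sequences `Cov_T(W∘Θ₀, τ_n W)` (`W = P_p(0) + P_q(y)`), `D_p(n+δ_p)`,
`D_q(n+δ_q)` are bounded by `S`, every slope at distance `≥ k ≥ 1` from both ends satisfies
`|X(m+1+δ_p) − X(m+δ_p)| ≤ (3/2)·S/k` — each sequence is non-negative and log-convex, hence midpoint-convex with
monotone slopes. [cite: GlimmJaffe1987, §6.1] -/
theorem abs_crossCov_step_le {β : ℝ} (hβ : 0 ≤ β) {L : ℕ} (hL : 1 ≤ L) {p q : Fin 4 × Fin 4} (hp : p.1 < p.2)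
    (hq : q.1 < q.2) (y : Site 4) (hy : y 0 = 0) {A B : ℕ} (hB : B + 4 ≤ 2 * L) {S : ℝ}
    (hSW : ∀ n, A ≤ n → n ≤ B → pairMirror G r β L p q y n ≤ S)
    (hSp : ∀ n : ℕ, A ≤ n → n ≤ B → diagCov G r β L p ((n : ℤ) + elec p) ≤ S)
    (hSq : ∀ n : ℕ, A ≤ n → n ≤ B → diagCov G r β L q ((n : ℤ) + elec q) ≤ S)
    {m k : ℕ} (hk : 1 ≤ k) (hm1 : A + k ≤ m) (hm2 : m + 1 + k ≤ B) :
    |crossCov G r β L p q y (((m + 1 : ℕ) : ℤ) + elec p) - crossCov G r β L p q y ((m : ℤ) + elec p)| ≤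
      3 / 2 * S / k := by
  -- the three midpoint-convex sequences
  have cW : ∀ i, A ≤ i → i + 2 ≤ B → 2 * pairMirror G r β L p q y (i + 1) ≤
      pairMirror G r β L p q y i + pairMirror G r β L p q y (i + 2) := fun i _ hi =>
    two_mul_le_add_of_sq_le_mul (pairMirror_nonneg G r hβ hL p q y hy (by omega))
      (pairMirror_nonneg G r hβ hL p q y hy (by omega)) (pairMirror_logConvex G r hβ hL p q y hy (by omega))
  have cp : ∀ i, A ≤ i → i + 2 ≤ B → 2 * diagCov G r β L p (((i + 1 : ℕ) : ℤ) + elec p) ≤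
      diagCov G r β L p ((i : ℤ) + elec p) + diagCov G r β L p (((i + 2 : ℕ) : ℤ) + elec p) := fun i _ hi =>
    two_mul_le_add_of_sq_le_mul (diagCov_mirror_nonneg G r hβ hL hp (by omega))
      (diagCov_mirror_nonneg G r hβ hL hp (by omega)) (diagCov_mirror_logConvex G r hβ hL hp (by omega))
  have cq : ∀ i, A ≤ i → i + 2 ≤ B → 2 * diagCov G r β L q (((i + 1 : ℕ) : ℤ) + elec q) ≤
      diagCov G r β L q ((i : ℤ) + elec q) + diagCov G r β L q (((i + 2 : ℕ) : ℤ) + elec q) := fun i _ hi =>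
    two_mul_le_add_of_sq_le_mul (diagCov_mirror_nonneg G r hβ hL hq (by omega))
      (diagCov_mirror_nonneg G r hβ hL hq (by omega)) (diagCov_mirror_logConvex G r hβ hL hq (by omega))
  -- slope bounds
  have sW := abs_slope_le (g := fun n => pairMirror G r β L p q y n) cW
    (fun i _ hi => pairMirror_nonneg G r hβ hL p q y hy (by omega)) hSW hk hm1 hm2
  have sp := abs_slope_le (g := fun n : ℕ => diagCov G r β L p ((n : ℤ) + elec p)) cp
    (fun i _ hi => diagCov_mirror_nonneg G r hβ hL hp (by omega)) hSp hk hm1 hm2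
  have sq' := abs_slope_le (g := fun n : ℕ => diagCov G r β L q ((n : ℤ) + elec q)) cq
    (fun i _ hi => diagCov_mirror_nonneg G r hβ hL hq (by omega)) hSq hk hm1 hm2
  -- polarisation
  have e0 := pairMirror_eq G r β L hp hq y hy m
  have e1 := pairMirror_eq G r β L hp hq y hy (m + 1)
  rw [abs_le] at sW sp sq'
  rw [show (3 / 2 * S / k : ℝ) = 3 / 2 * (S / k) from by ring, abs_le]
  constructor
  · linarith [sW.1, sp.2, sq'.2, e0, e1]
  · linarith [sW.2, sp.1, sq'.1, e0, e1]

end Summit.QuantumFields.YangMills.Cruxes.UniversalDetectorHankel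

end
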